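import Summits.NavierStokesRegularity.OSWSelfSimilar.OSWMechanismGlobalBranch02
import HarnessLib

/-!
# OSW self-similar mechanism, companion module (MECHANISM.md §§29–34: THEOREMS M32–M39) — part 03 of 09

1-D model (gCLM/OSW), computer-assisted; not Euler/NS.  Filed under `Summits/NavierStokesRegularity/OSWSelfSimilar/` by a prover-role courier on behalf of the
mechanism seat pub-oswblow-mech (planner-pub-oswblow-mech-g29-0), cell pub-oswblow (host summit NavierStokesRegularity); the gate admits the path but
not role planner.  CONTENT = the staged transcript `pub-oswblow-mech/lean/OSWMechanismGlobalBranch.lean` (sha256 4e5de3f87ec94598…,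
2998 lines), source lines 742–1110, UNCHANGED except: (i) namespace prefix `OSWSelfSimilar.Mechanism` → `Summit.NavierStokesRegularity.OSWSelfSimilar.Mechanism`;
(ii) the frames open at the cut (section (anonymous) › namespace Summit.NavierStokesRegularity.OSWSelfSimilar.Mechanism.ChordSlope) are re-opened above the body with their `open` commands replayed, and closed
at the end; (iii) this docstring.  Generated by `pub-oswblow-mech/lean/courier/make_split.py`; the parts must be filed IN ORDER
(each imports its predecessor).  First/last declarations here: `weight_integral_zero` … `chordSlopeDivergence_of` (28 in this part).
AI-written transcript; kernel-checked on the farm as ONE file before splitting (see the kit's CHECKS); to be checked, not trusted.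
COURIER NOTE (prover-role courier seat pub-oswblow-courier g2, 2026-08-25): in addition to the changes listed above, 1 one-line docstrings were added at filing on the declarations the transcript left undocumented (tree docstring rule); each only restates the formal statement of its declaration; nothing else was touched. List of the added docstrings: HOME `pub-oswblow-courier/g2/DOCSTRINGS.tsv`.
-/

noncomputable section
open Complex Set Filter
open scoped Topology
open Literature.Analysis.FluidPDE.OkamotoSakajoWunsch2008
namespace Summit.NavierStokesRegularity.OSWSelfSimilar.Mechanism.ChordSlope
open Summit.NavierStokesRegularity.OSWSelfSimilar.Mechanism.GlobalBranch

/-- LEMMA 30.4 (b): `∫₀^π w = (π/2)·2 − π + 0 = 0`. -/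
theorem weight_integral_zero :
    ∫ x in (0:ℝ)..Real.pi, (Real.pi / 2 * Real.sin x - (1 - Real.cos x)) = 0 := by
  have hW : ∀ x : ℝ, HasDerivAt (fun x => -(Real.pi / 2) * Real.cos x - x + Real.sin x)
      (Real.pi / 2 * Real.sin x - (1 - Real.cos x)) x := by
    intro x
    have h1 := (Real.hasDerivAt_cos x).const_mul (-(Real.pi / 2))
    have h2 := hasDerivAt_id' x
    have h3 := Real.hasDerivAt_sin x
    have h4 : HasDerivAt (fun x => -(Real.pi / 2) * Real.cos x - x + Real.sin x)
        (-(Real.pi / 2) * -Real.sin x - 1 + Real.cos x) x := (h1.sub h2).add h3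
    have e : -(Real.pi / 2) * -Real.sin x - 1 + Real.cos x = Real.pi / 2 * Real.sin x - (1 - Real.cos x) := by
      ring
    rw [e] at h4
    exact h4
  rw [intervalIntegral.integral_eq_sub_of_hasDerivAt (fun x _ => hW x)
      (by apply Continuous.intervalIntegrable; fun_prop)]
  simp only [Real.cos_pi, Real.sin_pi, Real.cos_zero, Real.sin_zero]
  ring

/-- LEMMA 30.4 (b), the Chebyshev step: `u` antitone, `w ≥ 0` left of `x₀` and `≤ 0` right of it ⇒
`u(x₀) w(x) ≤ u(x) w(x)` pointwise (integrate: `∫ u w ≥ u(x₀) ∫ w = 0`). -/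
theorem antitone_weight_pointwise (u w : ℝ → ℝ) (S : Set ℝ) (x₀ : ℝ) (hx₀ : x₀ ∈ S)
    (hu : AntitoneOn u S)
    (hw1 : ∀ x ∈ S, x ≤ x₀ → 0 ≤ w x) (hw2 : ∀ x ∈ S, x₀ ≤ x → w x ≤ 0) :
    ∀ x ∈ S, u x₀ * w x ≤ u x * w x := by
  intro x hx
  rcases le_total x x₀ with hle | hge
  · exact mul_le_mul_of_nonneg_right (hu hx hx₀ hle) (hw1 x hx hle)
  · exact mul_le_mul_of_nonpos_right (hu hx₀ hx hge) (hw2 x hx hge)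

/-- LEMMA 30.4 (b)/(20.5): with `A₀ = 1/(1−a)`, `A₀(A₀ − 4/(1+a)) = (5a−3)/((1−a)²(1+a))`. -/
theorem window_discriminant (a : ℝ) (ha : a < 1) (ha' : -1 < a) :
    1 / (1 - a) * (1 / (1 - a) - 4 / (1 + a)) = (5 * a - 3) / ((1 - a) ^ 2 * (1 + a)) := by
  have h1 : 1 - a ≠ 0 := ne_of_gt (by linarith)
  have h2 : 1 + a ≠ 0 := ne_of_gt (by linarith)
  field_simp
  ring

/-- LEMMA 30.4 (b): `B₀ < M/2` and `(M/π)² < D` give `B₀ < (π/2)√D`. -/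
theorem sink_upper_in_S (B0 M D : ℝ) (hD : 0 ≤ D) (h1 : B0 < M / 2)
    (h2 : (M / Real.pi) ^ 2 < D) : B0 < Real.pi / 2 * Real.sqrt D := by
  have hπ := Real.pi_pos
  have h3 : M / Real.pi < Real.sqrt D := by
    by_contra hcon
    have hcon : Real.sqrt D ≤ M / Real.pi := not_lt.mp hcon
    have := pow_le_pow_left₀ (Real.sqrt_nonneg D) hcon 2
    rw [Real.sq_sqrt hD] at this
    linarith
  have h4 : M < Real.pi * Real.sqrt D := by rwa [div_lt_iff₀' hπ] at h3
  linarith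

/-- LEMMA 30.4 (c): the leading coefficient `(8√2/(5π))² = 128/(25π²)` of `a^𝒮_P − 3/5 ∼ 128/(25π²(3P−5)²)`. -/
theorem aS_leading_coeff : (8 * Real.sqrt 2 / (5 * Real.pi)) ^ 2 = 128 / (25 * Real.pi ^ 2) := by
  have h2 : Real.sqrt 2 ^ 2 = 2 := Real.sq_sqrt (by norm_num)
  rw [div_pow, mul_pow, mul_pow, h2]
  ring

/-! ### THEOREM 30.3, Step 3: the odd one-signed steady states -/

/-- `v = κ g_v` in Fourier modes: `v̂_k (k + κ) = 0` for all `k ≥ 1` ⇒ at most one mode is non-zero. -/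
theorem single_mode_of_proportional (v : ℕ → ℝ) (κ : ℝ)
    (h : ∀ k : ℕ, 1 ≤ k → v k * ((k : ℝ) + κ) = 0) :
    ∀ j k : ℕ, 1 ≤ j → 1 ≤ k → v j ≠ 0 → v k ≠ 0 → j = k := by
  intro j k hj hk hvj hvk
  have h1 : (j : ℝ) + κ = 0 := by
    rcases mul_eq_zero.mp (h j hj) with h0 | h0
    · exact absurd h0 hvj
    · exact h0
  have h2 : (k : ℝ) + κ = 0 := by
    rcases mul_eq_zero.mp (h k hk) with h0 | h0
    · exact absurd h0 hvk
    · exact h0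
  have h3 : (j : ℝ) = (k : ℝ) := by linarith
  exact_mod_cast h3

/-- A one-signed `c sin(k₀x)` on `(0,π)` with `k₀ ≥ 2` vanishes: evaluate at `π/(2k₀)` and `3π/(2k₀)`. -/
theorem mode_one_of_one_signed (c : ℝ) (k₀ : ℕ) (hk : 2 ≤ k₀)
    (h : ∀ x : ℝ, 0 < x → x < Real.pi → c * Real.sin (k₀ * x) ≤ 0) : c = 0 := by
  have hπ := Real.pi_pos
  have hk2 : (2 : ℝ) ≤ k₀ := by exact_mod_cast hk
  have hk0 : (0 : ℝ) < k₀ := by linarith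
  have h1 := h (Real.pi / (2 * k₀)) (by positivity) (by
      rw [div_lt_iff₀ (by positivity)]; nlinarith)
  have e1 : (k₀ : ℝ) * (Real.pi / (2 * k₀)) = Real.pi / 2 := by field_simp
  rw [e1, Real.sin_pi_div_two, mul_one] at h1
  have h2 := h (3 * Real.pi / (2 * k₀)) (by positivity) (by
      rw [div_lt_iff₀ (by positivity)]; nlinarith)
  have e2 : (k₀ : ℝ) * (3 * Real.pi / (2 * k₀)) = Real.pi / 2 + Real.pi := by field_simp; ring
  rw [e2, Real.sin_add_pi, Real.sin_pi_div_two] at h2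
  linarith

/-! ### THEOREM M33: the spine, and the case `a → 3/5` -/

/-- THEOREM M33, the logical spine (predicate form): the three exclusions (near `a = 1`: THEOREM 30.3; near
`a = 3/5`: LEMMA 30.1 (a) with (20.5); on compact windows: LEMMA 30.1 (c) with (29.9)), each in the uniform form
`for every U, eventually P U holds on the regime`, imply `for every U, eventually P U`.  (The pen-and-paper proof argues
on sequences `σ_k → ∞` with `a(σ_k) → a_∞`; the uniform forms are equivalent to the sequential ones.) -/
theorem eventually_of_three_regimes (a : ℝ → ℝ) (P : ℝ → ℝ → Prop)
    (hE2 : ∀ U : ℝ, ∃ δ : ℝ, 0 < δ ∧ ∃ σ₀ : ℝ, ∀ σ, σ₀ < σ → 1 - δ < a σ → P U σ)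
    (hE3 : ∀ U : ℝ, ∃ δ : ℝ, 0 < δ ∧ ∃ σ₀ : ℝ, ∀ σ, σ₀ < σ → a σ < 3 / 5 + δ → P U σ)
    (hE1 : ∀ U a₁ a₂ : ℝ, 3 / 5 < a₁ → a₂ < 1 → ∃ σ₀ : ℝ, ∀ σ, σ₀ < σ → a σ ∈ Set.Icc a₁ a₂ → P U σ) :
    ∀ U : ℝ, ∃ σ₀ : ℝ, ∀ σ, σ₀ < σ → P U σ := by
  intro U
  obtain ⟨δ₂, hδ₂, σ₂, h₂⟩ := hE2 U
  obtain ⟨δ₃, hδ₃, σ₃, h₃⟩ := hE3 U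
  obtain ⟨σ₁, h₁⟩ := hE1 U (3 / 5 + δ₃) (1 - δ₂) (by linarith) (by linarith)
  refine ⟨max σ₁ (max σ₂ σ₃), fun σ hσ => ?_⟩
  have hσ1 : σ₁ < σ := lt_of_le_of_lt (le_max_left _ _) hσ
  have hσ2 : σ₂ < σ := lt_of_le_of_lt ((le_max_left _ _).trans (le_max_right _ _)) hσ
  have hσ3 : σ₃ < σ := lt_of_le_of_lt ((le_max_right _ _).trans (le_max_right _ _)) hσ
  by_cases hA : 1 - δ₂ < a σ
  · exact h₂ σ hσ2 hA
  by_cases hB : a σ < 3 / 5 + δ₃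
  · exact h₃ σ hσ3 hB
  exact h₁ σ hσ1 ⟨not_lt.mp hB, not_lt.mp hA⟩

/-- The same spine for a real quantity `s(σ)` (`P U σ := U < s σ`): the three exclusions imply `s → +∞`. -/
theorem diverges_of_three_regimes (a s : ℝ → ℝ)
    (hE2 : ∀ U : ℝ, ∃ δ : ℝ, 0 < δ ∧ ∃ σ₀ : ℝ, ∀ σ, σ₀ < σ → 1 - δ < a σ → U < s σ)
    (hE3 : ∀ U : ℝ, ∃ δ : ℝ, 0 < δ ∧ ∃ σ₀ : ℝ, ∀ σ, σ₀ < σ → a σ < 3 / 5 + δ → U < s σ)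
    (hE1 : ∀ U a₁ a₂ : ℝ, 3 / 5 < a₁ → a₂ < 1 → ∃ σ₀ : ℝ, ∀ σ, σ₀ < σ → a σ ∈ Set.Icc a₁ a₂ → U < s σ) :
    Tendsto s atTop atTop := by
  have h := eventually_of_three_regimes a (fun U σ => U < s σ) hE2 hE3 hE1
  rw [Filter.tendsto_atTop_atTop]
  intro U
  obtain ⟨σ₀, hσ₀⟩ := h U
  exact ⟨σ₀ + 1, fun σ hσ => (hσ₀ σ (by linarith)).le⟩

/-- THEOREM M33, the case `a → 3/5`: `‖F‖₂² ≥ ℓ > 0` (from (30.2) at bounded chord slope, `A₀ > 5/2`) against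
`‖F‖₂² ≤ N₁ M ≤ 3Ū M → 0` ((20.5)) is absurd. -/
theorem l2_sandwich_contra (L2 M : ℕ → ℝ) (ℓ U : ℝ) (hℓ : 0 < ℓ)
    (hlow : ∀ k, ℓ ≤ L2 k) (hup : ∀ k, L2 k ≤ 3 * U * M k)
    (hM : Tendsto M atTop (𝓝 0)) : False := by
  have h1 : Tendsto (fun k => 3 * U * M k) atTop (𝓝 (3 * U * 0)) := hM.const_mul (3 * U)
  rw [mul_zero] at h1
  have h2 : ∀ᶠ k in atTop, 3 * U * M k < ℓ := h1.eventually (gt_mem_nhds hℓ)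
  obtain ⟨k, hk⟩ := h2.exists
  linarith [hlow k, hup k]

/-! ### COROLLARY 30.6: the ladder from one a-priori bound -/

/-- COROLLARY 30.6 (a), first step: `𝔰 → ∞` and `𝔰 ≤ Ψ(B₀)` on `{B₀ ≥ b}` force `B₀ → 0`. -/
theorem sink_to_zero_of_slope_bound (s B0 : ℝ → ℝ)
    (hs : ∀ U : ℝ, ∃ σ₀ : ℝ, ∀ σ, σ₀ < σ → U < s σ)
    (hΨ : ∀ b : ℝ, 0 < b → ∃ C : ℝ, ∀ σ, 0 < σ → b ≤ B0 σ → s σ ≤ C) :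
    ∀ b : ℝ, 0 < b → ∃ σ₀ : ℝ, ∀ σ, σ₀ < σ → 0 < σ → B0 σ < b := by
  intro b hb
  obtain ⟨C, hC⟩ := hΨ b hb
  obtain ⟨σ₀, hσ₀⟩ := hs C
  refine ⟨σ₀, fun σ hσ hσpos => ?_⟩
  by_contra hcon
  have := hC σ hσpos (not_lt.mp hcon)
  linarith [hσ₀ σ hσ]

/-- COROLLARY 30.6 (a), second step: `B₀ → 0` forces `p = (1 + 1/B₀)/a → ∞` (`0 < a < 1`). -/
theorem p_unbounded_of_sink_to_zero (a B0 p : ℝ → ℝ)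
    (ha : ∀ σ, 0 < σ → 0 < a σ ∧ a σ < 1) (hB : ∀ σ, 0 < σ → 0 < B0 σ)
    (hp : ∀ σ, 0 < σ → p σ = (1 + 1 / B0 σ) / a σ)
    (hz : ∀ b : ℝ, 0 < b → ∃ σ₀ : ℝ, ∀ σ, σ₀ < σ → 0 < σ → B0 σ < b) :
    ∀ M : ℝ, ∃ σ : ℝ, 0 < σ ∧ M < p σ := by
  intro M
  obtain ⟨σ₀, hσ₀⟩ := hz (1 / (|M| + 1)) (by positivity)
  have hσpos : 0 < max σ₀ 0 + 1 := by have := le_max_right σ₀ 0; linarith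
  have hσgt : σ₀ < max σ₀ 0 + 1 := by have := le_max_left σ₀ 0; linarith
  have hBlt := hσ₀ _ hσgt hσpos
  have hBpos := hB _ hσpos
  obtain ⟨ha0, ha1⟩ := ha _ hσpos
  refine ⟨max σ₀ 0 + 1, hσpos, ?_⟩
  rw [hp _ hσpos]
  have h1 : |M| + 1 < 1 / B0 (max σ₀ 0 + 1) := by
    rw [lt_div_iff₀ hBpos]
    calc (|M| + 1) * B0 (max σ₀ 0 + 1) < (|M| + 1) * (1 / (|M| + 1)) :=
          mul_lt_mul_of_pos_left hBlt (by positivity)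
      _ = 1 := by field_simp
  have h2 : 1 + 1 / B0 (max σ₀ 0 + 1) ≤ (1 + 1 / B0 (max σ₀ 0 + 1)) / a (max σ₀ 0 + 1) := by
    rw [le_div_iff₀ ha0]
    have : 0 < 1 + 1 / B0 (max σ₀ 0 + 1) := by positivity
    nlinarith
  have h3 : M ≤ |M| := le_abs_self M
  linarith

/-- COROLLARY 30.6 (c): (28.4) `C₀ < π²(A₀+B₀)²/(4K sin x_m)` times `(1−a)²`, with `(1−a)A₀ = 1`, `𝔰 = (1−a)C₀`,
`(1−a)B₀ ≤ π/2`: `(1−a)K sin x_m < π²(1+(1−a)B₀)²/(4𝔰) ≤ π²(1+π/2)²/(4𝔰)`. -/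
theorem layer_degenerates_alg (e C0 A0 B0 K sx 𝔰 : ℝ) (he : 0 < e) (hK : 0 < K) (hsx : 0 < sx)
    (hsrc : e * A0 = 1) (hs : 𝔰 = e * C0) (h𝔰 : 0 < 𝔰) (hB : e * B0 ≤ Real.pi / 2) (hB0 : 0 ≤ B0)
    (h : C0 < Real.pi ^ 2 * (A0 + B0) ^ 2 / (4 * K * sx)) :
    e * K * sx < Real.pi ^ 2 * (1 + e * B0) ^ 2 / (4 * 𝔰) ∧
    Real.pi ^ 2 * (1 + e * B0) ^ 2 / (4 * 𝔰) ≤ Real.pi ^ 2 * (1 + Real.pi / 2) ^ 2 / (4 * 𝔰) := by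
  constructor
  · have h1 : C0 * (4 * K * sx) < Real.pi ^ 2 * (A0 + B0) ^ 2 := by
      rwa [lt_div_iff₀ (by positivity)] at h
    have h2 : e ^ 2 * (A0 + B0) ^ 2 = (1 + e * B0) ^ 2 := by
      have : e * (A0 + B0) = 1 + e * B0 := by rw [mul_add, hsrc]
      rw [← this]; ring
    rw [lt_div_iff₀ (by positivity), ← h2, hs]
    have h3 := mul_lt_mul_of_pos_left h1 (by positivity : 0 < e ^ 2)
    nlinarith [h3]
  · apply div_le_div_of_nonneg_right _ (by positivity)
    apply mul_le_mul_of_nonneg_left _ (by positivity)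
    apply pow_le_pow_left₀ (by positivity) _ 2
    linarith

/-! ### THEOREM 30.7: (29.10) in 𝒮_LC — the envelope chain -/

/-- THEOREM 30.7: (28.4) with the envelopes `B₀ < (π/2)A₀`, `A₀ ≤ A₂`, `K > π/(4 log 2)`, `sin x_m ≥ sin x₂`
gives `|f′(0)| < π log 2 (1+π/2)² A₂²/sin x₂ = 𝒩(b,a₂)`. -/
theorem slope_bound_LC_alg (C0 A0 B0 A2 K sx s2 : ℝ)
    (hA0 : 0 < A0) (hB0 : 0 < B0) (hA2 : A0 ≤ A2) (hK : Real.pi / (4 * Real.log 2) < K)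
    (hs2 : 0 < s2) (hsx : s2 ≤ sx) (hB : B0 < Real.pi / 2 * A0)
    (h : C0 < Real.pi ^ 2 * (A0 + B0) ^ 2 / (4 * K * sx)) :
    C0 < Real.pi * Real.log 2 * (1 + Real.pi / 2) ^ 2 * A2 ^ 2 / s2 := by
  have hπ := Real.pi_pos
  have hlog : 0 < Real.log 2 := Real.log_pos (by norm_num)
  have hKpos : 0 < K := lt_trans (by positivity) hK
  have hsxpos : 0 < sx := lt_of_lt_of_le hs2 hsx
  have hQ : (A0 + B0) ^ 2 ≤ (1 + Real.pi / 2) ^ 2 * A2 ^ 2 := by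
    have h1 : A0 + B0 ≤ (1 + Real.pi / 2) * A2 := by nlinarith
    have h0 : 0 ≤ A0 + B0 := by linarith
    calc (A0 + B0) ^ 2 ≤ ((1 + Real.pi / 2) * A2) ^ 2 := pow_le_pow_left₀ h0 h1 2
      _ = (1 + Real.pi / 2) ^ 2 * A2 ^ 2 := by ring
  have hπK : Real.pi ≤ 4 * K * Real.log 2 := by
    have := (div_lt_iff₀ (by positivity)).mp hK; linarith
  apply lt_of_lt_of_le h
  rw [div_le_div_iff₀ (by positivity) hs2]
  have step1 : Real.pi ^ 2 * (A0 + B0) ^ 2 * s2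
      ≤ Real.pi ^ 2 * ((1 + Real.pi / 2) ^ 2 * A2 ^ 2) * sx := by
    apply mul_le_mul _ hsx hs2.le (by positivity)
    exact mul_le_mul_of_nonneg_left hQ (by positivity)
  have step2 : Real.pi ^ 2 * ((1 + Real.pi / 2) ^ 2 * A2 ^ 2) * sx
      ≤ Real.pi * Real.log 2 * (1 + Real.pi / 2) ^ 2 * A2 ^ 2 * (4 * K * sx) := by
    calc Real.pi ^ 2 * ((1 + Real.pi / 2) ^ 2 * A2 ^ 2) * sx
        = (Real.pi * ((1 + Real.pi / 2) ^ 2 * A2 ^ 2) * sx) * Real.pi := by ring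
      _ ≤ (Real.pi * ((1 + Real.pi / 2) ^ 2 * A2 ^ 2) * sx) * (4 * K * Real.log 2) :=
          mul_le_mul_of_nonneg_left hπK (by positivity)
      _ = Real.pi * Real.log 2 * (1 + Real.pi / 2) ^ 2 * A2 ^ 2 * (4 * K * sx) := by ring
  linarith

/-! ### REMARK 30.8: the exact rescaling at the source -/

/-- (30.9): substituting `x = x_m ξ`, `F = KΦ`, `h = Kη`, `g = K x_m Γ`, `f′(x) = −(K/x_m)Φ′(ξ)` in (T1)
`a g f′ = f(h−1)` gives `aΓΦ′ = Φ(η − 1/K)` exactly. -/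
theorem inner_rescaling_identity (a K xm Γ Φ Φp η : ℝ) (hK : K ≠ 0) (hxm : xm ≠ 0)
    (h : a * (K * xm * Γ) * (-(K / xm) * Φp) = (-(K * Φ)) * (K * η - 1)) :
    a * Γ * Φp = Φ * (η - 1 / K) := by
  have lhs : a * (K * xm * Γ) * (-(K / xm) * Φp) = -(K ^ 2 * (a * Γ * Φp)) := by
    field_simp
  have rhs : (-(K * Φ)) * (K * η - 1) = -(K ^ 2 * (Φ * (η - 1 / K))) := by
    field_simp
  rw [lhs, rhs] at h
  have h' : K ^ 2 * (a * Γ * Φp) = K ^ 2 * (Φ * (η - 1 / K)) := by linarith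
  exact mul_left_cancel₀ (pow_ne_zero 2 hK) h'

/-! ### Hölder bookkeeping used by the typed reductions -/

/-- Scaling a Hölder function by a constant of modulus `≤ 1` keeps the Hölder constant
(`v = (1−a)f` with `0 < 1−a < 1`). -/
theorem holderWith_const_mul {C r : NNReal} {f : ℝ → ℝ} (hf : HolderWith C r f) (k : ℝ) (hk : |k| ≤ 1) :
    HolderWith C r (fun x => k * f x) := by
  intro x y
  have h1 : edist (k * f x) (k * f y) ≤ edist (f x) (f y) := by
    rw [edist_dist, edist_dist, Real.dist_eq, Real.dist_eq, ← mul_sub, abs_mul]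
    apply ENNReal.ofReal_le_ofReal
    calc |k| * |f x - f y| ≤ 1 * |f x - f y| := mul_le_mul_of_nonneg_right hk (abs_nonneg _)
      _ = |f x - f y| := one_mul _
  exact h1.trans (hf x y)

/-! #### Typed statements of §30 (Props over the profile hypothesis `NegP`, intended `NegP := NegProfileHyp`; no axiom,
no sorry) and the kernel-checked REDUCTIONS: THEOREM M33 on compact windows from `BranchFamily.escape` + LEMMA 30.1 (c)
(`BranchFamily.noBoundedSlope_on_window`), THEOREM M33 from its three regime exclusions (`BranchFamily.chordSlopeDiverges`),
COROLLARY 30.6 (a) (`BranchFamily.sink_to_zero`, `BranchFamily.p_unbounded`, `BranchFamily.ladder_of_slope_bound`,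
`BranchFamily.ladder_of_slope_apriori`) and COROLLARY 30.6 (b) (`BranchFamily.ladder_in_LC`). -/

/-- The CHORD BOUND `F ≤ N sin x` on `(0,π)` (`F = −f`); the chord slope `N₁(F)` of (30.1) is the least such `N`,
and `(1−a)N₁` is the blown-down chord slope `𝔰`. -/
def ChordBound (c : ℤ → ℂ) (N : ℝ) : Prop :=
  ∀ x : ℝ, 0 < x → x < Real.pi → -fR c x ≤ N * Real.sin x

/-- `ChordBound c N` is monotone in the constant: it persists for every `N′ ≥ N`. -/
theorem chordBound_mono {c : ℤ → ℂ} {N N' : ℝ} (h : ChordBound c N) (hle : N ≤ N') : ChordBound c N' := by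
  intro x hx hxπ
  have hs : 0 ≤ Real.sin x := Real.sin_nonneg_of_nonneg_of_le_pi hx.le hxπ.le
  exact (h x hx hxπ).trans (mul_le_mul_of_nonneg_right hle hs)

/-- **LEMMA 30.1 (c), typed (PROVED pen-and-paper: (30.2)–(30.3), Parseval, Privalov at `β = ½`, Morrey; the algebra is
`l2_lower_alg`, `cG_alg`, `fprime_pointwise_alg`, `sup_le_of_vanish_holder`):** HÖLDER FROM THE CHORD — for negative
class-(H) profiles with `q₀ = 1` (`(1−a)Hf(0) = 1`), `a ≥ a₁ > 3/5` and `F ≤ N sin x`, the `C^{0,β}` seminorm of `f` is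
bounded by a constant `R(a₁, N, β)` (indeed `f` is Lipschitz with constant `D_∞(a₁,N)`); no upper window is needed. -/
def HolderFromChordStatement (NegP : ℝ → (ℤ → ℂ) → Prop) : Prop :=
  ∀ β : NNReal, 0 < β → β ≤ 1 → ∀ a₁ N : ℝ, 3 / 5 < a₁ → a₁ < 1 → 0 < N →
    ∃ R : NNReal, ∀ (a : ℝ) (c : ℤ → ℂ), NegP a c → (1 - a) * HfR c 0 = 1 → a₁ ≤ a → a < 1 →
      ChordBound c N → HolderWith R β (fun x => fR c x)

/-- **THEOREM 30.3, typed shadow (PROVED pen-and-paper; RIGIDITY AT THE DE GREGORIO POINT):** negative simple-source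
profiles with `a` close to `1` and blown-down chord slope `≤ U` are uniformly close, after blow-down, to `−sin x`
(the pen-and-paper statement is convergence in `X^{0,β}`; Step 3 is `single_mode_of_proportional` +
`mode_one_of_one_signed`).  Listed for the record; the form THEOREM M33 consumes is `NoBoundedReturn` below. -/
def RigidityAtDGStatement (NegP : ℝ → (ℤ → ℂ) → Prop) : Prop :=
  ∀ U η : ℝ, 0 < η → ∃ δ : ℝ, 0 < δ ∧ ∀ (a : ℝ) (c : ℤ → ℂ), NegP a c → (1 - a) * HfR c 0 = 1 →
    1 - δ < a → a < 1 → ChordBound c (U / (1 - a)) → ∀ x : ℝ, |(1 - a) * fR c x + Real.sin x| < η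

/-- `𝔰(σ) → ∞` along a family, typed: for every `U`, eventually `(1−a)F(σ)` is NOT dominated by `U sin x`. -/
def ChordSlopeDiverges (aσ : ℝ → ℝ) (cσ : ℝ → ℤ → ℂ) : Prop :=
  ∀ U : ℝ, ∃ σU : ℝ, ∀ σ : ℝ, σU < σ → ¬ ChordBound (cσ σ) (U / (1 - aσ σ))

/-- THEOREM 30.3, Step 4, typed along a family (PROVED pen-and-paper for `𝔎`; uses the no-loop property THEOREM
M32 (b) and LEMMA 29.5 (b), which the type `BranchFamily` does not carry): no return to `a = 1` at bounded blown-down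
chord slope. -/
def NoBoundedReturn (aσ : ℝ → ℝ) (cσ : ℝ → ℤ → ℂ) : Prop :=
  ∀ U : ℝ, ∃ δ : ℝ, 0 < δ ∧ ∃ σ₀ : ℝ, ∀ σ : ℝ, σ₀ < σ → 1 - δ < aσ σ → ¬ ChordBound (cσ σ) (U / (1 - aσ σ))

/-- THEOREM M33, case `a → 3/5`, typed along a family (PROVED pen-and-paper: LEMMA 30.1 (a), (30.2), against
THEOREM M21 (20.5) of `OSWMechanism.lean`, not importable here; the contradiction is `l2_sandwich_contra`). -/
def NoBoundedCollapse (aσ : ℝ → ℝ) (cσ : ℝ → ℤ → ℂ) : Prop :=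
  ∀ U : ℝ, ∃ δ : ℝ, 0 < δ ∧ ∃ σ₀ : ℝ, ∀ σ : ℝ, σ₀ < σ → aσ σ < 3 / 5 + δ → ¬ ChordBound (cσ σ) (U / (1 - aσ σ))

/-- **THEOREM M33 on compact windows, KERNEL-CHECKED** from alternative (29.9) (`BranchFamily.escape`) and the typed
LEMMA 30.1 (c): on `[a₁,a₂] ⋐ (3/5,1)`, for `σ` large, the blown-down chord slope exceeds every `U`. -/
theorem _root_.Summit.NavierStokesRegularity.OSWSelfSimilar.Mechanism.GlobalBranch.BranchFamily.noBoundedSlope_on_window {NegP : ℝ → (ℤ → ℂ) → Prop} {β : NNReal} {aσ : ℝ → ℝ} {cσ : ℝ → ℤ → ℂ}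
    (hF : BranchFamily NegP β aσ cσ) (hβ0 : 0 < β) (hβ1 : β < 1) (hH : HolderFromChordStatement NegP) :
    ∀ U a₁ a₂ : ℝ, 3 / 5 < a₁ → a₂ < 1 → ∃ σ₀ : ℝ, ∀ σ : ℝ, σ₀ < σ → aσ σ ∈ Set.Icc a₁ a₂ →
      ¬ ChordBound (cσ σ) (U / (1 - aσ σ)) := by
  intro U a₁ a₂ h1 h2
  by_cases h12 : a₁ ≤ a₂
  · obtain ⟨R, hR⟩ := hH β hβ0 hβ1.le a₁ (|U| / (1 - a₂) + 1) h1 (by linarith) (by positivity)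
    obtain ⟨σR, hσR⟩ := hF.escape a₁ a₂ h1 h12 h2 R
    refine ⟨max σR 0, fun σ hσ ha => ?_⟩
    have hσR' : σR < σ := lt_of_le_of_lt (le_max_left _ _) hσ
    have hσ0 : 0 < σ := lt_of_le_of_lt (le_max_right _ _) hσ
    intro hcb
    have hwin := hF.window σ hσ0
    have h1a : 0 < 1 - aσ σ := by linarith [hwin.2]
    have hcb' : ChordBound (cσ σ) (|U| / (1 - a₂) + 1) := by
      apply chordBound_mono hcb
      have : U / (1 - aσ σ) ≤ |U| / (1 - a₂) :=
        calc U / (1 - aσ σ) ≤ |U| / (1 - aσ σ) := div_le_div_of_nonneg_right (le_abs_self U) h1a.le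
          _ ≤ |U| / (1 - a₂) := div_le_div_of_nonneg_left (abs_nonneg U) (by linarith) (by linarith [ha.2])
      linarith
    have hHol := hR (aσ σ) (cσ σ) (hF.profile σ hσ0) (hF.source σ hσ0) ha.1 hwin.2 hcb'
    have hk : |1 - aσ σ| ≤ 1 := by rw [abs_of_pos h1a]; linarith [hwin.1]
    exact hσR σ hσR' ha (holderWith_const_mul hHol (1 - aσ σ) hk)
  · exact ⟨0, fun σ _ ha => absurd (ha.1.trans ha.2) h12⟩

/-- **THEOREM 30.5 = THEOREM M33, typed and KERNEL-CHECKED as a reduction:** the blown-down chord slope diverges along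
a branch family, GIVEN the two regime exclusions the type cannot see (`NoBoundedReturn`: THEOREM 30.3;
`NoBoundedCollapse`: LEMMA 30.1 (a) with (20.5)) and the typed LEMMA 30.1 (c); the window case is kernel-checked. -/
theorem _root_.Summit.NavierStokesRegularity.OSWSelfSimilar.Mechanism.GlobalBranch.BranchFamily.chordSlopeDiverges {NegP : ℝ → (ℤ → ℂ) → Prop} {β : NNReal} {aσ : ℝ → ℝ} {cσ : ℝ → ℤ → ℂ}
    (hF : BranchFamily NegP β aσ cσ) (hβ0 : 0 < β) (hβ1 : β < 1) (hH : HolderFromChordStatement NegP)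
    (hE2 : NoBoundedReturn aσ cσ) (hE3 : NoBoundedCollapse aσ cσ) : ChordSlopeDiverges aσ cσ :=
  eventually_of_three_regimes aσ (fun U σ => ¬ ChordBound (cσ σ) (U / (1 - aσ σ))) hE2 hE3
    (hF.noBoundedSlope_on_window hβ0 hβ1 hH)

/-- **THEOREM M33, typed (its shadow on coefficient families):** for every `β ∈ (0,1)` the De Gregorio branch
continues as a branch family along which the blown-down chord slope diverges. -/
def ChordSlopeDivergenceStatement (NegP : ℝ → (ℤ → ℂ) → Prop) : Prop :=
  ∀ β : NNReal, 0 < β → β < 1 → ∃ (aσ : ℝ → ℝ) (cσ : ℝ → ℤ → ℂ), BranchFamily NegP β aσ cσ ∧ ChordSlopeDiverges aσ cσ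

/-- THEOREM M32 with the two regime exclusions of §30 attached to ITS curve (PROVED pen-and-paper: THEOREM 30.3 Step 4,
LEMMA 30.1 (a) + (20.5)). -/
def GlobalBranchV24Statement (NegP : ℝ → (ℤ → ℂ) → Prop) : Prop :=
  ∀ β : NNReal, 0 < β → β < 1 → ∃ (aσ : ℝ → ℝ) (cσ : ℝ → ℤ → ℂ), BranchFamily NegP β aσ cσ ∧
    NoBoundedReturn aσ cσ ∧ NoBoundedCollapse aσ cσ

/-- M32 + the exclusions + LEMMA 30.1 (c) ⇒ M33 (kernel-checked). -/
theorem chordSlopeDivergence_of {NegP : ℝ → (ℤ → ℂ) → Prop} (hG : GlobalBranchV24Statement NegP)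
    (hH : HolderFromChordStatement NegP) : ChordSlopeDivergenceStatement NegP := by
  intro β hβ0 hβ1
  obtain ⟨aσ, cσ, hF, hE2, hE3⟩ := hG β hβ0 hβ1
  exact ⟨aσ, cσ, hF, hF.chordSlopeDiverges hβ0 hβ1 hH hE2 hE3⟩

end Summit.NavierStokesRegularity.OSWSelfSimilar.Mechanism.ChordSlope
end
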